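import Summits.SmoothPoincare4.SmoothPoincare4.Theses.ZeroSurgeryExotic
import Summits.SmoothPoincare4.SmoothPoincare4.Theorems.ZeroSurgeryExoticZseSVanishesOnPairsEmbedDontDissolveDefs
import Summits.SmoothPoincare4.SmoothPoincare4.Theorems.ZeroSurgeryExoticZseSVanishesOnPairsEmbedReduction
import Literature.Uncategorized.Crux
import Literature.Topology.FourManifolds.OrientedConnectedSumAssoc
import Literature.Topology.FourManifolds.SmoothOrientationConnectedProofs
import Summits.SmoothPoincare4.SmoothPoincare4.Statement

/-!
# Line `embed-dont-dissolve` — skeleton r4 for crux `ZeroSurgeryExotic.ZseSVanishesOnPairs` (stmt-SmoothPoincare4-0368)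

Crux (ledger signature verbatim = the tree's registered open statement `Literature.Uncategorized.SVanishesOnPairs`):
for knots `K, K'` with a common `0`-surgery `Y` and `K` smoothly slice, every Rasmussen invariant `s` of `K'` is `0`.

Lead prover-line-stmt-SmoothPoincare4-0368-1, reshape r4 (2026-08-16).  Everything this line proves is now IN THE TREE,
so the skeleton has shrunk to its two open stubs and one application:

* the four transport stubs of the planner's skeleton / lead -0's reshape r1 are ACCEPTED Theorems files
  (`…PairSphereData` p78044, `…ChartOrientation` p78557, `…TransportPuncture` p78588, `…MirrorChart` p78836);
* the BET is NAMED in the tree: `PuncturedPairSpheresEmbedIn o` (Defs file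
  `Theorems/ZeroSurgeryExoticZseSVanishesOnPairsEmbedDontDissolveDefs.lean`, p97269) — for every Manolescu–Piccirillo
  pair-sphere datum `(K, K', g, X ≃ₕ S⁴, e, f, j, oX, q)` with `q` off the slice data, the puncture `(X ∖ {q}, oX)` embeds
  smoothly and orientation-preservingly in some `o`-tower `#ᵗ(ℂℙ², o)` (`IsProjectiveTower`);
* the ENGINE is the Literature named fact `Knot.rasmussen_nonpos_of_isTowerSlice` (MMSW 2023 Cor. 1.9, knot case;
  `ProjectiveTowers.lean`, p78844; undischarged, XL: Lee-homology cobordism maps are not in the tree);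
* the COMPOSITION `engine ∧ (∃ o, bet o) ⇒ crux` is the accepted theorem
  `sVanishesOnPairs_of_towerEngine_of_exists_puncturedPairSpheresEmbedIn` of
  `Theorems/ZeroSurgeryExoticZseSVanishesOnPairsEmbedReduction.lean` (p96114 + its append), which also carries the
  calibration `puncturedPairSpheresEmbedIn_of_spc4` (`SmoothPoincare4 ⇒ ∀ o, bet o`) — so the line's position
  `SPC4 ⇒ bet ⇒ crux (mod engine)` is kernel-checked, and the bet's height-`0` truncation is the route's kill switch
  `Assembly2` (`Theorems/ZseSVanishesOnPairs/Negative/HeightZero.lean`).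

## Registered stubs (the only `sorry`s)

1. `stub_puncturedPairSphereEmbeds : ∃ o, PuncturedPairSpheresEmbedIn o` — THE BET (open; crux-sized: implied by SPC4,
   irrefutable short of an exotic `S⁴` by Disproof §§12, 15; proved on paper on the meridional / `ℤ`-slice sub-class,
   `Cruxes/ZseSVanishesOnPairs/NOTES.md` Theorem A, audited in Disproof §13; residual = Criterion C there).
2. `stub_mmswOneSided : Knot.rasmussen_nonpos_of_isTowerSlice` — THE ENGINE (published theorem, undischarged named fact).

`ZseSVanishesOnPairs_of : ZseSVanishesOnPairs` concludes the crux BY ITS ROUTE NAME (local materialisation §0: the route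
file carries item 0368 only as a TODO comment) and `sVanishesOnPairs_of` under its tree name.
-/

noncomputable section

set_option linter.dupNamespace false

open scoped Manifold ContDiff Topology
open Set Function ContinuousMap
open Literature.Topology.FourManifolds

/-! ## §0 Local materialisation of the route decl (delete when the gate writes it) -/

namespace Summit.SmoothPoincare4.SmoothPoincare4.Theses.ZeroSurgeryExotic

/-- **LOCAL MATERIALISATION — item stmt-SmoothPoincare4-0368 · crux · rank 4** (ledger signature verbatim; the
gate-written route file `Theses/ZeroSurgeryExotic.lean` carries this decl only as a TODO comment until
`import Literature.Topology.FourManifolds.LeeRasmussen` is added there — delete this block then).  On a `0`-surgery pair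
with `K` smoothly slice, every Rasmussen invariant of `K'` vanishes. [cite: ManolescuMarengonSarkarWillis2023, Question 9.11] -/
def ZseSVanishesOnPairs : Prop :=
  ∀ (K K' : Literature.Topology.FourManifolds.Knot) (Y : Type) [TopologicalSpace Y] [ChartedSpace (EuclideanSpace ℝ (Fin 3)) Y] (s : ℤ), Literature.Topology.FourManifolds.IsIntegralSurgery (𝓡 3) Y K 0 → Literature.Topology.FourManifolds.IsIntegralSurgery (𝓡 3) Y K' 0 → K.IsSmoothlySlice → K'.HasRasmussenInvariant s → s = 0

/-- The local materialisation IS the tree's registered open statement of item 0368, definitionally. [folklore] -/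
theorem zseSVanishesOnPairs_iff_sVanishesOnPairs :
    ZseSVanishesOnPairs ↔ Literature.Uncategorized.SVanishesOnPairs := Iff.rfl

end Summit.SmoothPoincare4.SmoothPoincare4.Theses.ZeroSurgeryExotic

namespace Summit.SmoothPoincare4.SmoothPoincare4.Cruxes.ZseSVanishesOnPairs.EmbedDontDissolve

open Summit.SmoothPoincare4.SmoothPoincare4.Theses.ZeroSurgeryExotic
open Summit.SmoothPoincare4.SmoothPoincare4.Theorems.ZseSVanishesOnPairs

/-! ## §1 The two registered stubs -/

/-- **STUB 1b — THE BET** (held by the lead; OPEN): for one orientation `o` of `ℂℙ²`, every Manolescu–Piccirillo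
pair-sphere datum with its puncture off the slice data embeds orientation-preservingly in an `o`-tower
(`PuncturedPairSpheresEmbedIn o`, Defs file).  `SmoothPoincare4 ⇒` it for every `o` (`puncturedPairSpheresEmbedIn_of_spc4`);
with the engine it gives the crux; refuting it exhibits a homotopy 4-sphere not diffeomorphic to `S⁴`.
[cite: ManolescuPiccirillo2023, Def. 2.4, Lemma 3.5 and Thm. 3.9] [cite: ManolescuMarengonSarkarWillis2023, Question 9.12] -/
theorem stub_puncturedPairSphereEmbeds :
    ∃ o : SmoothOrientation (𝓡 4) ComplexProjectivePlane, PuncturedPairSpheresEmbedIn o := by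
  sorry

/-- **STUB 3 — THE ENGINE**: MMSW 2023 Cor. 1.9, knot case, one chirality — verbatim the Literature named fact
`Knot.rasmussen_nonpos_of_isTowerSlice` (undischarged; its printed proof needs Lee-homology cobordism maps and MMSW's `s`
for links in `#ʳ(S¹ × S²)`, absent from the tree). [cite: ManolescuMarengonSarkarWillis2023, Cor. 1.9, Def. 6.2, Cor. 6.13 and Remark 6.6] -/
theorem stub_mmswOneSided : Knot.rasmussen_nonpos_of_isTowerSlice := by
  sorry

/-! ## §2 The composition (accepted tree theorems) -/

/-- **THE SKELETON THEOREM: the crux BY NAME** from the two registered stubs, by the accepted reduction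
`sVanishesOnPairs_of_towerEngine_of_exists_puncturedPairSpheresEmbedIn` (Theorems/…EmbedReduction.lean, p96114 + p97964).
[cite: ManolescuMarengonSarkarWillis2023, Cor. 1.9 and Question 9.11] -/
theorem ZseSVanishesOnPairs_of : ZseSVanishesOnPairs :=
  sVanishesOnPairs_of_towerEngine_of_exists_puncturedPairSpheresEmbedIn stub_mmswOneSided stub_puncturedPairSphereEmbeds

/-- The same under the crux's tree name `Literature.Uncategorized.SVanishesOnPairs`. [cite: ManolescuMarengonSarkarWillis2023, Question 9.11] -/
theorem sVanishesOnPairs_of : Literature.Uncategorized.SVanishesOnPairs :=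
  ZseSVanishesOnPairs_of

/-- **Calibration (tree theorem `puncturedPairSpheresEmbedIn_of_spc4`)**: `SmoothPoincare4 ⇒` the bet for every `o`, so the
bet is not stronger than the summit. [cite: ManolescuPiccirillo2023, §1 p. 1] -/
theorem bet_of_spc4 (hS : _root_.SmoothPoincare4) (o : SmoothOrientation (𝓡 4) ComplexProjectivePlane) :
    PuncturedPairSpheresEmbedIn o :=
  puncturedPairSpheresEmbedIn_of_spc4 hS o

end Summit.SmoothPoincare4.SmoothPoincare4.Cruxes.ZseSVanishesOnPairs.EmbedDontDissolve

end
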